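import Summits.BirchSwinnertonDyer.BirchSwinnertonDyer.Theorems.ByReductionTypeAtTwoAdditiveKatoTransportPrintExactAnyImagePrintDoors
import Summits.BirchSwinnertonDyer.BirchSwinnertonDyer.Theorems.ByReductionTypeAtTwoAdditiveKatoTransportPrintExactAnyImageNonvanishingNegTwo
import Literature.NumberTheory.EllipticCurves.AnalyticRankOrderProofs
import HarnessLib

/-!
# Route ByReductionTypeAtTwo, crux C4″ `AdditivePotMultOverKAtTwo` (stmt-BirchSwinnertonDyer-22618; parent
# `AdditiveRankZeroAtTwo` 19098) — R18, part 2: the split-twist block doors AT PRINT LEVEL with NO normalisation binders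
# — displayed = PRINT ×5 BY NAME + the ONE typed input + `r_an(W) = 0` + the curve/tower/newform themselves
# (theorems only)

Cell `bsd-2adic`, seat `bsd-2adic-k4-w3` GEN 6. GEN 5's print-level doors
`katoDivisibility_neg{One,Two}SplitTwist_two_of_print_of_input` (`…PrintExactAnyImagePrintDoors`, p708200) display, besides
four PRINT facts and the ONE typed input, three groups of «DATA» that are not data: (α) `(Lt, m, hLt : ι Lt = 2^m·L⁻,
hLt0 : Lt ≠ 0)` — an integral multiple of the odd branch ASSUMED non-zero (discharged by R18 part 1,
`…PrintExactAnyImageNonvanishing{,NegTwo}`: `L̃` exists with `m = 0` and `L̃ ≠ 0 ⟸ L(W,1) ≠ 0`); (β) `(θ, hθ : θ² = d,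
hγθ : γ • θ = θ)` — the generator is asked to FIX `√d`, which given `IsCyclotomicVariable 2 γ` selects one of the two lift
classes of `γ` (`χ(γ) = 5` fixes `√−1` and negates `√−2`): a normalisation («WLOG, rekey» in p708200's docstring); (γ) a
model `F ∋ θ_F` of `ℚ(√d)`. This file performs (β) in the kernel and produces (γ) internally:

* §1 `isTopGenerator_mul_of_mem_kerSubgroup`, `isCyclotomicVariable_mul_of_mem_kerSubgroup` — for `c ∈ ker κ` (`κ`
  cyclotomic: `χ(c)` is torsion) the shifted lift `γ·c` is again a topological generator matching the cyclotomic variable;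
  `forall_selmerDualData_of_rekey` / `…_of_eq` / `…_inv_of_mul` — a «`∀ D : X(W/ℚ_∞)` keyed `γ·c`» clause gives the clause
  keyed `γ` (`SelmerDualData.rekey`: `conj_c = id` on `H¹(ℚ_∞, E[2^∞])`, SAME module — Greenberg §1 p. 60), clauses transport
  along equal keys, and `(γc)⁻¹ = γ⁻¹·(γ c⁻¹ γ⁻¹)` handles key `γ⁻¹`.
* §2 `exists_numberField_sq_eq_of_neg` — a model `QuadraticAlgebra ℚ d 0` of `ℚ(√d)`, `d < 0`.
* §3 **`katoDivisibility_negOneSplitTwist_two_of_print_of_analyticRank_eq_zero`** — (−1)-block: for the ADDITIVE `W` with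
  `W^{(−1)}` split multiplicative at `2` and `r_an(W) = 0`, from {`Kato2004.thm12_4`, Greenberg Thm. 1.14 ×2, Greenberg Thm. 1.5,
  `hasEntireLFunction_rat`} (PRINT, BY NAME) and the ONE image-free input: `∃ L̃ ∈ Λ`, `ι L̃ = L⁻₂(f, 1, ω, T)`, `L̃ ≠ 0`, with
  (i) `ℓ_𝔮(X(W/ℚ_∞)) ≤ ℓ_𝔮(Λ/(L̃))` at every height-one `𝔮 ∌ 2` for every key-`γ` dual Selmer datum, (ii) the same for every
  key-`γ⁻¹` datum, (iii) the same for every key-`γ` datum of every `W₁ ∼_ℚ W` (Kato's member of the reducible block) — for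
  EVERY topological generator `γ` matching the cyclotomic variable (if `γ` negates `i`, the door of p708200 is run at `γc`,
  `c ∈ ker κ` a complex conjugation, GEN 5's `AddKatoTwoQuadLayer.exists_mem_kerSubgroup_smul_sqrt_eq_neg_of_neg`, and every datum
  is re-keyed).
* §4 **`katoDivisibility_negTwoSplitTwist_two_of_print_of_analyticRank_eq_zero`** — the (−2)-block twin (`ι L̃ = L⁻₂(f, 1, ω·χ₂, T)`).

What stays displayed is genuine data: the curve `W` (globally minimal), a globally minimal `ℚ`-model `W′` of `W^{(d)}`
(`V • W = W′^{(d)}`), the newform `f` of `W^{(d)}`, and the cyclotomic `ℤ₂`-tower `κ` with a topological generator `γ`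
matching the Mazur–Tate–Teitelbaum variable.

HONEST FRAMING (D-0036 / D-0054): theorems only — no definition, no named fact, no instance, no `sorry`;
route-independent; CONDITIONAL on `Kato2004.thm12_4`, `Greenberg1999_thm114_charIdeal_iota_invariant`,
`Greenberg1999.thm114_charIdeal_iota_invariant_splitMult_baseChange`, `Greenberg1999.thm15_isTorsion_multiplicative_rat`,
`hasEntireLFunction_rat` (PRINT, hypotheses BY NAME) and on the typed input
`KatoOddBranchInputsAtTwoNegOneSplitTwistPrintExactAnyImage` (conjecture-grade at `2`: Coleman clause of the odd branch
beyond print); types-the-object-of (the Iwasawa-level word of all four split-twist blocks of C4″ becomes «PRINT ×5 + ONE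
typed input + `r_an(W) = 0` (the crux's own hypothesis) + the objects themselves»); closes none (the block targets
`KatoSharpAtTwoAdditiveNeg{One,Two}SplitTwist` / `KatoMemberSharp…Reducible` still need the descent READING T1–T14 / R1–R13
and, on the irreducible blocks, (A)); nothing booked; BSD is not proved by any of this. PARTITION: X5@2 additive
potentially-multiplicative block, the four split-twist sub-blocks (169 + 39 classes) × `p = 2`.

References: [Kato2004Asterisque] Thm. 12.4 (p. 221), Thm. 12.5 (3) with (12.5.1) (p. 222), Thm. 17.4 (1) (p. 273), §17.13
(pp. 279–280); [GreenbergLNM1716] §1 (p. 60), Thm. 1.5 (p. 61), Thm. 1.14 (p. 68), §4 (p. 107); [Washington1997] §13.1;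
[MazurTateTeitelbaum1986Invent] §I.8 (8.6), §I.10 (10.1), §I.12–I.14, §I.17; [SilvermanAEC2009] VII.5 Prop. 5.1 (b), X.2,
X.5 Cor. 5.4; memo `run/shared/lean/pub/bsd-2adic/k4w3/gen6/VERDICT-22618-k4w3-GEN6.md`.
-/

set_option autoImplicit false
-- the summit's namespace `Summit.BirchSwinnertonDyer.BirchSwinnertonDyer` (Sub = Summit) trips `dupNamespace`
set_option linter.dupNamespace false

noncomputable section

open scoped Classical MatrixGroups ModularForm NumberField

open Field CongruenceSubgroup WeierstrassCurve IsDedekindDomain Literature.NumberTheory.EllipticCurves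
  Literature.NumberTheory.EllipticCurves.ModularForms Literature.NumberTheory.EllipticCurves.IwasawaAlgebra
  Literature.NumberTheory.EllipticCurves.Module Literature.NumberTheory.EllipticCurves.Greenberg1999
  Literature.NumberTheory.GaloisRepresentations Summit.BirchSwinnertonDyer.BirchSwinnertonDyer.Theorems

namespace Summit.BirchSwinnertonDyer.BirchSwinnertonDyer.Theorems.AddKatoTwo

/-! ## §1 Shifting the generator inside `ker κ` and re-keying dual Selmer data -/

section Rekey

variable {p : ℕ} [Fact p.Prime] (κ : ZpExtension ℚ p)

/-- `γ·c` is a topological generator whenever `γ` is and `c ∈ ker κ` (`κ(γc) = κ(γ)·κ(c) = 1·0` additively).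
[cite: Washington1997, §13.1] -/
theorem isTopGenerator_mul_of_mem_kerSubgroup {γ c : absoluteGaloisGroup ℚ} (hγ : κ.IsTopGenerator γ)
    (hc : c ∈ κ.kerSubgroup) : κ.IsTopGenerator (γ * c) := by
  rw [ZpExtension.mem_kerSubgroup] at hc
  unfold ZpExtension.IsTopGenerator at hγ ⊢
  rw [map_mul, hγ, hc, mul_one]

/-- For the CYCLOTOMIC tower, `γ·c` matches the cyclotomic variable whenever `γ` does and `c ∈ ker κ`: `ker κ = χ⁻¹(μ(ℤ_p))`,
so `χ(c)` is a torsion unit and `χ(γc)·(χ(c)⁻¹ζ) = χ(γ)ζ = γ_cyc`. [cite: GreenbergLNM1716, §1 (p. 60)] [cite: Washington1997, §13.1] -/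
theorem isCyclotomicVariable_mul_of_mem_kerSubgroup (hκ : κ.IsCyclotomic) {γ c : absoluteGaloisGroup ℚ}
    (hγ' : IsCyclotomicVariable p γ) (hc : c ∈ κ.kerSubgroup) : IsCyclotomicVariable p (γ * c) := by
  obtain ⟨ζ, hζ, hγζ⟩ := hγ'
  have hcχ : IsOfFinOrder (GaloisRep.cyclotomicCharacter ℚ p c) := by
    have h : c ∈ (CommGroup.torsion ℤ_[p]ˣ).comap (GaloisRep.cyclotomicCharacter ℚ p).toMonoidHom := hκ ▸ hc
    exact h
  refine ⟨(GaloisRep.cyclotomicCharacter ℚ p c)⁻¹ * ζ, hcχ.inv.mul hζ, ?_⟩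
  rw [← hγζ, map_mul]
  congr 1
  group

variable {κ} {W₀ : WeierstrassCurve ℚ} (Lt : IwasawaAlgebra p)

/-- A divisibility clause quantified over the dual Selmer data keyed `γ·c`, `c ∈ ker κ`, gives the clause keyed `γ`:
`D ↦ D.rekey` has the SAME module. [cite: GreenbergLNM1716, §1 (p. 60)] -/
theorem forall_selmerDualData_of_rekey {γ c : absoluteGaloisGroup ℚ} (hc : c ∈ κ.kerSubgroup)
    (h : ∀ (D : W₀.SelmerDualData κ (γ * c)) (𝔮 : PrimeSpectrum (IwasawaAlgebra p)), 𝔮.asIdeal.height = 1 →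
      PowerSeries.C (p : ℤ_[p]) ∉ 𝔮.asIdeal →
      lengthAt (IwasawaAlgebra p) D.X 𝔮 ≤ lengthAt (IwasawaAlgebra p) (IwasawaAlgebra p ⧸ Ideal.span {Lt}) 𝔮) :
    ∀ (D : W₀.SelmerDualData κ γ) (𝔮 : PrimeSpectrum (IwasawaAlgebra p)), 𝔮.asIdeal.height = 1 →
      PowerSeries.C (p : ℤ_[p]) ∉ 𝔮.asIdeal →
      lengthAt (IwasawaAlgebra p) D.X 𝔮 ≤ lengthAt (IwasawaAlgebra p) (IwasawaAlgebra p ⧸ Ideal.span {Lt}) 𝔮 :=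
  fun D 𝔮 h𝔮 hp𝔮 ↦ h (D.rekey hc) 𝔮 h𝔮 hp𝔮

/-- Transport of a divisibility clause along equal keys. [folklore] -/
theorem forall_selmerDualData_of_eq {γ₁ γ₂ : absoluteGaloisGroup ℚ} (e : γ₁ = γ₂)
    (h : ∀ (D : W₀.SelmerDualData κ γ₁) (𝔮 : PrimeSpectrum (IwasawaAlgebra p)), 𝔮.asIdeal.height = 1 →
      PowerSeries.C (p : ℤ_[p]) ∉ 𝔮.asIdeal →
      lengthAt (IwasawaAlgebra p) D.X 𝔮 ≤ lengthAt (IwasawaAlgebra p) (IwasawaAlgebra p ⧸ Ideal.span {Lt}) 𝔮) :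
    ∀ (D : W₀.SelmerDualData κ γ₂) (𝔮 : PrimeSpectrum (IwasawaAlgebra p)), 𝔮.asIdeal.height = 1 →
      PowerSeries.C (p : ℤ_[p]) ∉ 𝔮.asIdeal →
      lengthAt (IwasawaAlgebra p) D.X 𝔮 ≤ lengthAt (IwasawaAlgebra p) (IwasawaAlgebra p ⧸ Ideal.span {Lt}) 𝔮 := by
  subst e
  exact h

/-- The key-`γ⁻¹` clause from the key-`(γc)⁻¹` clause (`c ∈ ker κ`): `(γc)⁻¹ = γ⁻¹·(γ c⁻¹ γ⁻¹)` with `γ c⁻¹ γ⁻¹ ∈ ker κ`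
(normal subgroup), then re-key. [cite: GreenbergLNM1716, §1 (p. 60)] -/
theorem forall_selmerDualData_inv_of_mul {γ c : absoluteGaloisGroup ℚ} (hc : c ∈ κ.kerSubgroup)
    (h : ∀ (D : W₀.SelmerDualData κ (γ * c)⁻¹) (𝔮 : PrimeSpectrum (IwasawaAlgebra p)), 𝔮.asIdeal.height = 1 →
      PowerSeries.C (p : ℤ_[p]) ∉ 𝔮.asIdeal →
      lengthAt (IwasawaAlgebra p) D.X 𝔮 ≤ lengthAt (IwasawaAlgebra p) (IwasawaAlgebra p ⧸ Ideal.span {Lt}) 𝔮) :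
    ∀ (D : W₀.SelmerDualData κ γ⁻¹) (𝔮 : PrimeSpectrum (IwasawaAlgebra p)), 𝔮.asIdeal.height = 1 →
      PowerSeries.C (p : ℤ_[p]) ∉ 𝔮.asIdeal →
      lengthAt (IwasawaAlgebra p) D.X 𝔮 ≤ lengthAt (IwasawaAlgebra p) (IwasawaAlgebra p ⧸ Ideal.span {Lt}) 𝔮 := by
  have hg : γ * c⁻¹ * γ⁻¹ ∈ κ.kerSubgroup := (ZpExtension.kerSubgroup_normal κ).conj_mem _ (inv_mem hc) γ
  have e : (γ * c)⁻¹ = γ⁻¹ * (γ * c⁻¹ * γ⁻¹) := by group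
  exact forall_selmerDualData_of_rekey Lt hg (forall_selmerDualData_of_eq Lt e h)

end Rekey

/-! ## §2 A model of `ℚ(√d)`, `d < 0` -/

/-- **A model of the imaginary quadratic field `ℚ(√d)`** (`d < 0` rational): a number field `F` of degree `2` with an element
`θ` satisfying `θ² = d` — Mathlib's `QuadraticAlgebra ℚ d 0` (a field, as `d < 0` is not a rational square). Used to
discharge the «any model `F ∋ θ_F` of `ℚ(√d)`» binder of the print-level doors. [folklore] -/
theorem exists_numberField_sq_eq_of_neg {d : ℚ} (hd : d < 0) :
    ∃ (F : Type) (_ : Field F) (_ : NumberField F) (θ : F), θ ^ 2 = algebraMap ℚ F d ∧ Module.finrank ℚ F = 2 := by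
  -- adapted from `Literature.NumberTheory.QuadraticFields.Quadratic.exists_numberField_discr_eq`
  haveI : Fact (∀ r : ℚ, r ^ 2 ≠ d + 0 * r) := ⟨fun r h ↦ by nlinarith [sq_nonneg r]⟩
  let L := QuadraticAlgebra ℚ d 0
  haveI : NumberField L := NumberField.of_module_finite ℚ L
  have h2L : Module.finrank ℚ L = 2 := by convert QuadraticAlgebra.finrank_eq_two d (0 : ℚ)
  refine ⟨L, inferInstance, inferInstance, QuadraticAlgebra.omega, ?_, h2L⟩
  have h := QuadraticAlgebra.omega_mul_omega_eq_add (a := d) (b := (0 : ℚ))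
  rw [zero_smul, add_zero] at h
  rw [sq, h, Algebra.algebraMap_eq_smul_one]

/-! ## §3 The (−1)-block -/

section NegOne

variable (W : WeierstrassCurve ℚ) [W.IsElliptic] [W.IsGloballyMinimal] [ContinuousSMul ℤ_[2] (W.tateModule 2)]
  (W' : WeierstrassCurve ℚ) [W'.IsElliptic] [W'.IsGloballyMinimal] {V : VariableChange ℚ} (hV : V • W = W'.quadraticTwist (-1))
  {N : ℕ} [NeZero N] (f : CuspForm (Gamma0 N) 2) (κ : ZpExtension ℚ 2) (γ : absoluteGaloisGroup ℚ)
  (hsp : (W.quadraticTwist (-1)).HasSplitMultiplicativeReductionAtPrime 2)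
  (hκ : κ.IsCyclotomic) (hγ : κ.IsTopGenerator γ) (hγ' : IsCyclotomicVariable 2 γ)
  (hf : IsNewformOf (W.quadraticTwist (-1)) f)

include hV hsp hκ hγ hγ' hf in
/-- **THE (−1)-BLOCK DOORS AT PRINT LEVEL — ANY image, EVERY generator, the odd-branch multiple SUPPLIED.** For the
ADDITIVE `W` whose twist by `−1` is split multiplicative at `2`, with `r_an(W) = 0` (the crux's hypothesis verbatim;
`L(W,1) ≠ 0` by the tree theorem `analyticRank_eq_zero_iff_holds`), from {`Kato2004.thm12_4`, Greenberg Thm. 1.14 over `ℚ`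
and over `F`, Greenberg Thm. 1.5, modularity `hasEntireLFunction_rat`} (PRINT, BY NAME), the ONE image-free input
`KatoOddBranchInputsAtTwoNegOneSplitTwistPrintExactAnyImage`, and the objects `W′` (`V • W = W′^{(−1)}`), `f`, `κ`, `γ`: there
is `L̃ ∈ Λ = ℤ₂⟦T⟧` with `ι L̃ = L⁻₂(f, 1, ω, T)` (the odd branch of the one-term Mazur–Tate–Teitelbaum measure of `W^{(−1)}`,
integral) and `L̃ ≠ 0`, such that (i) `ℓ_𝔮(X(W/ℚ_∞)) ≤ ℓ_𝔮(Λ/(L̃))` at every height-one `𝔮 ∌ 2` for every key-`γ` dual Selmer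
datum; (ii) the same for every key-`γ⁻¹` datum; (iii) the same for every key-`γ` datum of every `W₁ ∼_ℚ W`. GEN 5's
`katoDivisibility_negOneSplitTwist_two_of_print_of_input` (p708200) with `θ, hθ, hγθ` performed as a WLOG (§1: if `γ • i = −i`
the door runs at `γc`, `c ∈ ker κ` a complex conjugation, and every datum is re-keyed), `F` produced (§2), and
`(Lt, m, hLt, hLt0)` discharged (`exists_iwasawa_lift_oddBranch_ne_zero`, `m = 0`).
[cite: Kato2004Asterisque, Thm. 12.4 (p. 221), Thm. 12.5 (3) and (12.5.1) (p. 222), Thm. 17.4 (1) (p. 273), §17.13 (pp. 279–280)]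
[cite: GreenbergLNM1716, §1 (p. 60), Thm. 1.5 (p. 61), Thm. 1.14 (p. 68), §4 (p. 107)]
[cite: MazurTateTeitelbaum1986Invent, §I.8 (8.6), §I.12–I.14, §I.17] [cite: Washington1997, §13.1] -/
theorem katoDivisibility_negOneSplitTwist_two_of_print_of_analyticRank_eq_zero (h12 : Kato2004.thm12_4)
    (hPE : KatoOddBranchInputsAtTwoNegOneSplitTwistPrintExactAnyImage) (h114 : Greenberg1999_thm114_charIdeal_iota_invariant)
    (h114F : Greenberg1999.thm114_charIdeal_iota_invariant_splitMult_baseChange) (h15 : thm15_isTorsion_multiplicative_rat)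
    (hmod : hasEntireLFunction_rat) (hr : W.analyticRank = 0) :
    ∃ Lt : IwasawaAlgebra 2, iwasawaToPowerSeries 2 Lt = padicLFunctionMinusBranchMult f (1 : ℚ_[2]) 1 ∧ Lt ≠ 0 ∧
    (∀ (D : W.SelmerDualData κ γ) (𝔮 : PrimeSpectrum (IwasawaAlgebra 2)), 𝔮.asIdeal.height = 1 →
      PowerSeries.C (2 : ℤ_[2]) ∉ 𝔮.asIdeal →
      lengthAt (IwasawaAlgebra 2) D.X 𝔮 ≤ lengthAt (IwasawaAlgebra 2) (IwasawaAlgebra 2 ⧸ Ideal.span {Lt}) 𝔮) ∧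
    (∀ (D' : W.SelmerDualData κ γ⁻¹) (𝔮 : PrimeSpectrum (IwasawaAlgebra 2)), 𝔮.asIdeal.height = 1 →
      PowerSeries.C (2 : ℤ_[2]) ∉ 𝔮.asIdeal →
      lengthAt (IwasawaAlgebra 2) D'.X 𝔮 ≤ lengthAt (IwasawaAlgebra 2) (IwasawaAlgebra 2 ⧸ Ideal.span {Lt}) 𝔮) ∧
    (∀ (W₁ : WeierstrassCurve ℚ) [W₁.IsElliptic], IsIsogenous W W₁ →
      ∀ (D₁ : W₁.SelmerDualData κ γ) (𝔮 : PrimeSpectrum (IwasawaAlgebra 2)), 𝔮.asIdeal.height = 1 →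
      PowerSeries.C (2 : ℤ_[2]) ∉ 𝔮.asIdeal →
      lengthAt (IwasawaAlgebra 2) D₁.X 𝔮 ≤ lengthAt (IwasawaAlgebra 2) (IwasawaAlgebra 2 ⧸ Ideal.span {Lt}) 𝔮) := by
  haveI : Fact (Nat.Prime 2) := ⟨Nat.prime_two⟩
  haveI : (W.quadraticTwist (-1 : ℚ)).IsElliptic := W.isElliptic_quadraticTwist (by norm_num)
  have hL : W.entireLFunction 1 ≠ 0 := (WeierstrassCurve.analyticRank_eq_zero_iff_holds (hmod W)).mp hr
  -- (α) the odd-branch multiple: `W ≅ (W^{(−1)})^{(−1)}`, `W^{(−1)}` split multiplicative at `2` with newform `f`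
  have hWtw : ∃ C : VariableChange ℚ, C • (W.quadraticTwist (-1 : ℚ)).quadraticTwist (-1) = W := by
    obtain ⟨C, hC⟩ := W.exists_variableChange_quadraticTwist_one
    exact ⟨C⁻¹, by rw [quadraticTwist_quadraticTwist, show (-1 : ℚ) * -1 = 1 by norm_num, ← hC, inv_smul_smul]⟩
  obtain ⟨Lt, hLt, hLt0⟩ :=
    exists_iwasawa_lift_oddBranch_ne_zero W (W.quadraticTwist (-1 : ℚ)) hWtw hf hsp hmod hL
  have hLt' : iwasawaToPowerSeries 2 Lt = padicLFunctionMinusBranchMult f (1 : ℚ_[2]) 1 := by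
    rw [hLt, pow_zero, map_one, one_mul]
  -- (γ) a model of `ℚ(√−1)`
  obtain ⟨F, _, _, θF, hθF, hF2⟩ := exists_numberField_sq_eq_of_neg (d := -1) (by norm_num)
  rw [map_neg, map_one] at hθF
  -- (β) the door of p708200 at every generator FIXING `i`, then the WLOG
  obtain ⟨θ, hθ⟩ := AddKatoTwoQuadLayer.exists_sqrt (-1)
  have key : ∀ γ₀ : absoluteGaloisGroup ℚ, κ.IsTopGenerator γ₀ → IsCyclotomicVariable 2 γ₀ → γ₀ • θ = θ →
      (∀ (D : W.SelmerDualData κ γ₀) (𝔮 : PrimeSpectrum (IwasawaAlgebra 2)), 𝔮.asIdeal.height = 1 →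
        PowerSeries.C (2 : ℤ_[2]) ∉ 𝔮.asIdeal →
        lengthAt (IwasawaAlgebra 2) D.X 𝔮 ≤ lengthAt (IwasawaAlgebra 2) (IwasawaAlgebra 2 ⧸ Ideal.span {Lt}) 𝔮) ∧
      (∀ (D' : W.SelmerDualData κ γ₀⁻¹) (𝔮 : PrimeSpectrum (IwasawaAlgebra 2)), 𝔮.asIdeal.height = 1 →
        PowerSeries.C (2 : ℤ_[2]) ∉ 𝔮.asIdeal →
        lengthAt (IwasawaAlgebra 2) D'.X 𝔮 ≤ lengthAt (IwasawaAlgebra 2) (IwasawaAlgebra 2 ⧸ Ideal.span {Lt}) 𝔮) ∧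
      (∀ (W₁ : WeierstrassCurve ℚ) [W₁.IsElliptic], IsIsogenous W W₁ →
        ∀ (D₁ : W₁.SelmerDualData κ γ₀) (𝔮 : PrimeSpectrum (IwasawaAlgebra 2)), 𝔮.asIdeal.height = 1 →
        PowerSeries.C (2 : ℤ_[2]) ∉ 𝔮.asIdeal →
        lengthAt (IwasawaAlgebra 2) D₁.X 𝔮 ≤ lengthAt (IwasawaAlgebra 2) (IwasawaAlgebra 2 ⧸ Ideal.span {Lt}) 𝔮) :=
    fun γ₀ hγ₀ hγ₀' hγ₀θ ↦ katoDivisibility_negOneSplitTwist_two_of_print_of_input W W' hV hθ f κ γ₀ hsp hκ hγ₀ hγ₀' hγ₀θ hf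
      Lt 0 hLt hLt0 F hθF hF2 h12 hPE h114 h114F h15
  refine ⟨Lt, hLt', hLt0, ?_⟩
  rcases QuadraticTwistSelmer.smul_sqrt_eq_or_eq_neg hθ γ with hγθ | hγθ
  · exact key γ hγ hγ' hγθ
  · obtain ⟨c, hc, hcθ⟩ :=
      AddKatoTwoQuadLayer.exists_mem_kerSubgroup_smul_sqrt_eq_neg_of_neg κ (by norm_num : (-1 : ℚ) < 0) hθ
    have hγcθ : (γ * c) • θ = θ := by rw [mul_smul, hcθ, smul_neg, hγθ, neg_neg]
    obtain ⟨h1, h2, h3⟩ := key (γ * c) (isTopGenerator_mul_of_mem_kerSubgroup κ hγ hc)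
      (isCyclotomicVariable_mul_of_mem_kerSubgroup κ hκ hγ' hc) hγcθ
    have h2c : PowerSeries.C ((2 : ℕ) : ℤ_[2]) = PowerSeries.C (2 : ℤ_[2]) := by norm_num
    refine ⟨?_, ?_, ?_⟩
    · have h := forall_selmerDualData_of_rekey (W₀ := W) Lt hc (by simpa only [h2c] using h1)
      simpa only [h2c] using h
    · have h := forall_selmerDualData_inv_of_mul (W₀ := W) Lt hc (by simpa only [h2c] using h2)
      simpa only [h2c] using h
    · intro W₁ _ hiso
      have h := forall_selmerDualData_of_rekey (W₀ := W₁) Lt hc (by simpa only [h2c] using h3 W₁ hiso)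
      simpa only [h2c] using h

end NegOne

/-! ## §4 The (−2)-block -/

section NegTwo

variable (W : WeierstrassCurve ℚ) [W.IsElliptic] [W.IsGloballyMinimal] [ContinuousSMul ℤ_[2] (W.tateModule 2)]
  (W' : WeierstrassCurve ℚ) [W'.IsElliptic] [W'.IsGloballyMinimal] {V : VariableChange ℚ} (hV : V • W = W'.quadraticTwist (-2))
  {N : ℕ} [NeZero N] (f : CuspForm (Gamma0 N) 2) (κ : ZpExtension ℚ 2) (γ : absoluteGaloisGroup ℚ)
  (hsp : (W.quadraticTwist (-2)).HasSplitMultiplicativeReductionAtPrime 2)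
  (hκ : κ.IsCyclotomic) (hγ : κ.IsTopGenerator γ) (hγ' : IsCyclotomicVariable 2 γ)
  (hf : IsNewformOf (W.quadraticTwist (-2)) f)

include hV hsp hκ hγ hγ' hf in
/-- **THE (−2)-BLOCK DOORS AT PRINT LEVEL — ANY image, EVERY generator, the `χ₂`-twisted odd-branch multiple SUPPLIED.**
For the ADDITIVE `W` whose twist by `−2` is split multiplicative at `2`, with `r_an(W) = 0`, from the five PRINT facts BY NAME,
the ONE image-free `(−1)` input (through R15), and the objects `W′` (`V • W = W′^{(−2)}`), `f`, `κ`, `γ`: there is `L̃ ∈ Λ` with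
`ι L̃ = L⁻₂(f, 1, ω·χ₂, T)` (the `χ₂`-twisted odd branch of the one-term measure of `W^{(−2)}`) and `L̃ ≠ 0`, with the three
divisibility clauses (key `γ`, key `γ⁻¹`, every `W₁ ∼_ℚ W`). p708200's `katoDivisibility_negTwoSplitTwist_two_of_print_of_input`
with `θ = √−2, hθ, hγθ` performed as a WLOG (§1), `F` produced (§2), and `(Lt, m, hLt, hLt0)` discharged
(`exists_iwasawa_lift_oddBranchTwist_ne_zero`, `m = 0`).
[cite: Kato2004Asterisque, Thm. 12.4 (p. 221), Thm. 12.5 (3) and (12.5.1) (p. 222), Thm. 17.4 (1) (p. 273), §17.13 (pp. 279–280)]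
[cite: GreenbergLNM1716, §1 (p. 60), Thm. 1.5 (p. 61), Thm. 1.14 (p. 68), §4 (p. 107)]
[cite: MazurTateTeitelbaum1986Invent, §I.8 (8.6), §I.12–I.14, §I.17] [cite: Washington1997, §13.1] -/
theorem katoDivisibility_negTwoSplitTwist_two_of_print_of_analyticRank_eq_zero (h12 : Kato2004.thm12_4)
    (hPE : KatoOddBranchInputsAtTwoNegOneSplitTwistPrintExactAnyImage) (h114 : Greenberg1999_thm114_charIdeal_iota_invariant)
    (h114F : Greenberg1999.thm114_charIdeal_iota_invariant_splitMult_baseChange) (h15 : thm15_isTorsion_multiplicative_rat)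
    (hmod : hasEntireLFunction_rat) (hr : W.analyticRank = 0) :
    ∃ Lt : IwasawaAlgebra 2,
      iwasawaToPowerSeries 2 Lt = padicLFunctionMinusBranchMultTwist f (1 : ℚ_[2]) 1 (-1) ∧ Lt ≠ 0 ∧
    (∀ (D : W.SelmerDualData κ γ) (𝔮 : PrimeSpectrum (IwasawaAlgebra 2)), 𝔮.asIdeal.height = 1 →
      PowerSeries.C (2 : ℤ_[2]) ∉ 𝔮.asIdeal →
      lengthAt (IwasawaAlgebra 2) D.X 𝔮 ≤ lengthAt (IwasawaAlgebra 2) (IwasawaAlgebra 2 ⧸ Ideal.span {Lt}) 𝔮) ∧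
    (∀ (D' : W.SelmerDualData κ γ⁻¹) (𝔮 : PrimeSpectrum (IwasawaAlgebra 2)), 𝔮.asIdeal.height = 1 →
      PowerSeries.C (2 : ℤ_[2]) ∉ 𝔮.asIdeal →
      lengthAt (IwasawaAlgebra 2) D'.X 𝔮 ≤ lengthAt (IwasawaAlgebra 2) (IwasawaAlgebra 2 ⧸ Ideal.span {Lt}) 𝔮) ∧
    (∀ (W₁ : WeierstrassCurve ℚ) [W₁.IsElliptic], IsIsogenous W W₁ →
      ∀ (D₁ : W₁.SelmerDualData κ γ) (𝔮 : PrimeSpectrum (IwasawaAlgebra 2)), 𝔮.asIdeal.height = 1 →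
      PowerSeries.C (2 : ℤ_[2]) ∉ 𝔮.asIdeal →
      lengthAt (IwasawaAlgebra 2) D₁.X 𝔮 ≤ lengthAt (IwasawaAlgebra 2) (IwasawaAlgebra 2 ⧸ Ideal.span {Lt}) 𝔮) := by
  haveI : Fact (Nat.Prime 2) := ⟨Nat.prime_two⟩
  haveI : (W.quadraticTwist (-2 : ℚ)).IsElliptic := W.isElliptic_quadraticTwist (by norm_num)
  have hL : W.entireLFunction 1 ≠ 0 := (WeierstrassCurve.analyticRank_eq_zero_iff_holds (hmod W)).mp hr
  -- (α) the twisted odd-branch multiple: `W ≅ (W^{(−2)})^{(−2)}` (`(−2)·(−2) = 1·2²`)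
  have hWtw : ∃ C : VariableChange ℚ, C • (W.quadraticTwist (-2 : ℚ)).quadraticTwist (-2) = W := by
    obtain ⟨C, hC⟩ := W.exists_variableChange_quadraticTwist_one
    obtain ⟨C₂, hC₂⟩ := W.exists_variableChange_quadraticTwist_mul_sq (1 : ℚ) (2 : ℚ) two_ne_zero
    refine ⟨C⁻¹ * C₂⁻¹, ?_⟩
    rw [quadraticTwist_quadraticTwist, show (-2 : ℚ) * -2 = 1 * 2 ^ 2 by norm_num, ← hC₂, ← hC, mul_smul,
      inv_smul_smul, inv_smul_smul]
  obtain ⟨Lt, hLt, hLt0⟩ :=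
    exists_iwasawa_lift_oddBranchTwist_ne_zero W (W.quadraticTwist (-2 : ℚ)) hWtw hf hsp hmod hL
  have hLt' : iwasawaToPowerSeries 2 Lt = padicLFunctionMinusBranchMultTwist f (1 : ℚ_[2]) 1 (-1) := by
    rw [hLt, pow_zero, map_one, one_mul]
  -- (γ) a model of `ℚ(√−2)`
  obtain ⟨F, _, _, θF, hθF, hF2⟩ := exists_numberField_sq_eq_of_neg (d := -2) (by norm_num)
  rw [map_neg, map_ofNat] at hθF
  -- (β) the door of p708200 at every generator FIXING `√−2`, then the WLOG
  obtain ⟨θ, hθ⟩ := AddKatoTwoQuadLayer.exists_sqrt (-2)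
  have key : ∀ γ₀ : absoluteGaloisGroup ℚ, κ.IsTopGenerator γ₀ → IsCyclotomicVariable 2 γ₀ → γ₀ • θ = θ →
      (∀ (D : W.SelmerDualData κ γ₀) (𝔮 : PrimeSpectrum (IwasawaAlgebra 2)), 𝔮.asIdeal.height = 1 →
        PowerSeries.C (2 : ℤ_[2]) ∉ 𝔮.asIdeal →
        lengthAt (IwasawaAlgebra 2) D.X 𝔮 ≤ lengthAt (IwasawaAlgebra 2) (IwasawaAlgebra 2 ⧸ Ideal.span {Lt}) 𝔮) ∧
      (∀ (D' : W.SelmerDualData κ γ₀⁻¹) (𝔮 : PrimeSpectrum (IwasawaAlgebra 2)), 𝔮.asIdeal.height = 1 →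
        PowerSeries.C (2 : ℤ_[2]) ∉ 𝔮.asIdeal →
        lengthAt (IwasawaAlgebra 2) D'.X 𝔮 ≤ lengthAt (IwasawaAlgebra 2) (IwasawaAlgebra 2 ⧸ Ideal.span {Lt}) 𝔮) ∧
      (∀ (W₁ : WeierstrassCurve ℚ) [W₁.IsElliptic], IsIsogenous W W₁ →
        ∀ (D₁ : W₁.SelmerDualData κ γ₀) (𝔮 : PrimeSpectrum (IwasawaAlgebra 2)), 𝔮.asIdeal.height = 1 →
        PowerSeries.C (2 : ℤ_[2]) ∉ 𝔮.asIdeal →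
        lengthAt (IwasawaAlgebra 2) D₁.X 𝔮 ≤ lengthAt (IwasawaAlgebra 2) (IwasawaAlgebra 2 ⧸ Ideal.span {Lt}) 𝔮) :=
    fun γ₀ hγ₀ hγ₀' hγ₀θ ↦ katoDivisibility_negTwoSplitTwist_two_of_print_of_input W W' hV hθ f κ γ₀ hsp hκ hγ₀ hγ₀' hγ₀θ hf
      Lt 0 hLt hLt0 F hθF hF2 h12 hPE h114 h114F h15
  refine ⟨Lt, hLt', hLt0, ?_⟩
  rcases QuadraticTwistSelmer.smul_sqrt_eq_or_eq_neg hθ γ with hγθ | hγθ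
  · exact key γ hγ hγ' hγθ
  · obtain ⟨c, hc, hcθ⟩ :=
      AddKatoTwoQuadLayer.exists_mem_kerSubgroup_smul_sqrt_eq_neg_of_neg κ (by norm_num : (-2 : ℚ) < 0) hθ
    have hγcθ : (γ * c) • θ = θ := by rw [mul_smul, hcθ, smul_neg, hγθ, neg_neg]
    obtain ⟨h1, h2, h3⟩ := key (γ * c) (isTopGenerator_mul_of_mem_kerSubgroup κ hγ hc)
      (isCyclotomicVariable_mul_of_mem_kerSubgroup κ hκ hγ' hc) hγcθ
    have h2c : PowerSeries.C ((2 : ℕ) : ℤ_[2]) = PowerSeries.C (2 : ℤ_[2]) := by norm_num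
    refine ⟨?_, ?_, ?_⟩
    · have h := forall_selmerDualData_of_rekey (W₀ := W) Lt hc (by simpa only [h2c] using h1)
      simpa only [h2c] using h
    · have h := forall_selmerDualData_inv_of_mul (W₀ := W) Lt hc (by simpa only [h2c] using h2)
      simpa only [h2c] using h
    · intro W₁ _ hiso
      have h := forall_selmerDualData_of_rekey (W₀ := W₁) Lt hc (by simpa only [h2c] using h3 W₁ hiso)
      simpa only [h2c] using h

end NegTwo

end Summit.BirchSwinnertonDyer.BirchSwinnertonDyer.Theorems.AddKatoTwo

end
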